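/-
Copyright: lit-balaban cell, Phase-2 proof seat p33 (gen 10).  Statement-level skeleton of a published paper; no proof claims beyond
what the kernel checks below.
-/
import Literature.MathematicalPhysics.QuantumFieldTheory.BalabanImbrieJaffe1984to88.BIJ85SigmaTranslationInvariance
import Literature.MathematicalPhysics.QuantumFieldTheory.BalabanImbrieJaffe1984to88.BIJ85Prop521Torus

/-!
# `BalabanImbrieJaffe1984to88.BIJ85TorusReflections` — T. Bałaban, J. Imbrie, A. Jaffe, *Renormalization of the Higgs model:
minimizers, propagators and the stability of mean field theory*, Commun. Math. Phys. **97** (1985) 299–329 [BalabanImbrieJaffe1985]: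
the **CENTRE REFLECTIONS `x_ρ ↦ −x_ρ − 1` of the nested tori** and the covariance under them of the finite-lattice calculus of
Sect. 2 / Sect. 4.1 — `∂`, `∂*`, `Δ`, the straight runs (2.5), the staircase contours and the axial gauge (3.4)/(4.1.2), the block
averages `Q`, `Q′`, `Q_k`, `Q′_k` (2.13), the edge pull-back `Q^{e*}` (2.22) and its composite `Q^{e*}_k` (2.24), and the support
`δ_{k,Ax}(A)` of (4.1.1)/(4.1.2) — file 1/3 of the gen-10 member of SKELETON row
**C1.Eq7.3.1-7.3.2** (the k-UNIFORM line-sum constant of the second printed form of (7.3.2) by reflection symmetry; GAPS G-C1-05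
ADDENDA 7–8 item (γ′))

statement-level skeleton of published theorems with citation tags; proofs where landed; nothing here is a claim about the Yang–Mills mass gap

WHY (reading note; the use is in files 2–3).  p. 326 [PDF 28]: *"The second form of the inequality substitutes v_b for u_k(b) in the
covariant derivative of φ. These inequalities can be proved by an extension of the proofs of [7]."*  The tree's located constant for
the second form is p11's `BIJ85Claim73SecondForm.SecClosedIdx.hT` (`η·|Σ_{b′⊂b}(T_kg)_{b′}| ≤ K_T·max|g|`, `T_k = 𝒟_k∂*Q^{e*}_k`),
proved in the tree only linearly in `k` (p09 `BIJ85LineSumTkBound`, d = 2).  The k-UNIFORM bound follows from a SYMMETRY of the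
operators of record: every ingredient of `T_k` (centred blocks of `Setup`, centred staircase trees `LatticeFieldCalculus.IsAxial`,
straight-line averages, the Landau operators of (4.4.1), `Q^{e*}_k`, `∂`; `Q^{s*}_k` enters only through its class modulo the
axial-gauge constraint space, file 2) is covariant under the reflections
`x_ρ ↦ −x_ρ − 1` of the centred labels — the reflections through the hyperplane `{x_ρ = −½}`, which is a BLOCK BOUNDARY AT EVERY
LEVEL (the substrate cell's `T4Covariance`: *"the reflections 'preserving the torus T^{(k+1)}' of [Balaban1987RG1] (2.17) … in the
centred labels of EVERY level read x_ρ ↦ −x_ρ − 1"*, `Site.emb_creflect`, `AveragingReflection.blockOf_creflect`).  This file is the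
V1-calculus half (real-valued bond/site/plaquette fields); file 2 (`BIJ85TkCovariance`) lifts it to `H_{j,Ax}`, `C^{(j)}`, `H_j`, `𝒟_k`,
`T_k`; file 3 (`BIJ85LineSumReflection`) is the line-sum argument.

THE PRINTED TEXT whose objects are reflected here (all quoted in the files that typed them; pages re-read this session, `lit read
paper:balaban1985-cmp97-bij-higgs-minimizers`, PDF = journal − 298): (2.4)–(2.5) p. 302 the lattice derivative and
`u(Γ) = Π_{b∈Γ}u_b`; (2.7) p. 303 gauge transformations of site fields; (2.13) p. 304 the bond average; (2.20)–(2.22) p. 305 the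
plaquette average, `B^e(p′)`, `Q^e`, `Q^{e*}`; (2.24) p. 305 `Q^e_k = (Q^e)^k`; (3.4) p. 306 the axial trees; (4.1.2) p. 309
`δ_{k,Ax}(A) = Π_{j<k}δ_{Ax}(Q_jA)`.

WHAT IS DEFINED (defs with bodies) / PROVED (0 `sorry`, standard axioms, no `def … : Prop`, nothing of the tree re-declared).
* §0 `crefl ρ x = (x.reflect ρ).unshift ρ` — the substrate's centre reflection of the labels of `T^{(j)}` (its involution
  `B12GaugeFixInvariance269.creflectSite_creflectSite`, blocks-to-blocks `AveragingReflection.blockOf_creflect`, centres-to-centres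
  `T4Covariance.Site.emb_creflect` BY NAME); its action on unit steps, straight runs, the block points `Site.blockSite` (offset `ρ`
  flipped, `flipOff`).
* §1 the induced maps on positively oriented bonds `breflect` (a `ρ`-bond goes to the `ρ`-bond ending at the image of its source,
  traversed backwards) and plaquettes `preflect` (orientation reversed iff `ρ` is one of the two directions), both involutions; the
  pull-backs `reflV` (bond fields, sign `−1` on `ρ`-bonds), `reflS` (site functions), `reflP` (plaquette functions, sign `−1` on
  plaquettes containing the direction `ρ`): involutive, additive.
* §2 **covariance of the lattice calculus**: `grad`, `diverg`, `laplace`, `curl` (`curl c (reflV ρ A) = reflP ρ (curl c A)`).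
* §3 one level: straight runs `segSum`/`runSum` (a reflected `ρ`-run is the reversed run from the image of its END point), the
  staircase sums `stairSum` and **the centred axial gauge `IsAxial` is reflection invariant** (the trees — all `μ`-bonds whose
  lower coordinates sit at the block centre — go to trees), the averages `bondAvg`/`siteAvg` (`Q(reflV A) = reflV (QA)` one level up).
* §4 k levels: `bondAvgIter`, `siteAvgIter`, `deltaAx`, `constraint411` (the support of (4.1.1)) are reflection covariant/invariant.
* §5 the edge sets `B^e(p′)` / `Q^{e*}` of p31's `BIJ85CurlQsstar.torusEdgeCells` and the composite `BIJ85Eq531Inputs.QestarIter` are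
  reflection covariant (`Q^{e*}(reflP g) = reflP (Q^{e*}g)`, standing range).
* §A (translations, complementing own g3 `BIJ85SigmaTranslationInvariance`): `grad_translS`, `diverg_translV`, `laplace_translS` — the
  unit-lattice translations of the Landau operators needed next to the reflections in file 2 (a reflection through the boundary
  `{x_ρ = z_ρ − ½}` of a general k-block is `crefl ρ` followed by a unit-lattice translation).
HONEST SCOPE.  Pure finite-lattice bookkeeping on the tori of `Setup` (standing range `j + 1 ≤ m + K` where blocks are involved);
nothing analytic; no statement of the paper is asserted here.  NOT treated: the surface pull-back `Q^{s*}` (2.17) itself (file 2 uses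
only its class modulo the constraint space `V411`, via `Q ∘ Q^{s*} = id`), and coordinate permutations (the staircase trees are not
permutation symmetric).

CITATION HEADER (lean-in-tree rule).  Phase-2 file of the lit-balaban TYPED SKELETON (HOME `run/shared/lean/pub/lit-balaban/`), seat
p33 gen 10 (unit `lit-balaban-p33-g10`; TAKING line HOME/STATUS.md 2026-08-22T03:08Z; owner r15, referee ref-5).
-/

namespace Literature.MathematicalPhysics.QuantumFieldTheory.BalabanImbrieJaffe1984to88.BIJ85TorusReflections

open Literature.MathematicalPhysics.QuantumFieldTheory.Balaban1983to89
open LatticeFieldCalculus BIJ85AxialPropagator411 B12GaugeFixInvariance269 BIJ85SigmaTranslationInvariance AveragingReflection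

noncomputable section

variable {P : Params} {j : ℕ} {V : Type*}

/-! ## §0  The centre reflection of the labels and the block geometry -/

/-- **The centre reflection** `x_ρ ↦ −x_ρ − 1` of the labels of `T^{(j)}` (the substrate's `(x.reflect ρ).unshift ρ`): the reflection
through the hyperplane `{x_ρ = −½}`, a block boundary at every level of the centred block geometry of `Setup`.
[cite: BalabanImbrieJaffe1985, (2.4) p.302] -/
def crefl (ρ : Fin P.d) (x : Balaban1983to89.Site P j) : Balaban1983to89.Site P j := (x.reflect ρ).unshift ρ

/-- `crefl` coordinatewise. [cite: BalabanImbrieJaffe1985, (2.4) p.302] -/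
theorem crefl_apply (ρ : Fin P.d) (x : Balaban1983to89.Site P j) (ν : Fin P.d) :
    crefl ρ x ν = if ν = ρ then -x ρ - 1 else x ν := by
  unfold crefl
  by_cases h : ν = ρ
  · subst h; simp [Site.reflect_apply]
  · simp [Site.unshift_apply, Site.reflect_apply, h]

/-- `crefl` is the substrate's centre reflection `(x.reflect ρ).unshift ρ` (definitional). [cite: BalabanImbrieJaffe1985, (2.4) p.302] -/
theorem crefl_eq (ρ : Fin P.d) (x : Balaban1983to89.Site P j) : crefl ρ x = (x.reflect ρ).unshift ρ := rfl

/-- The centre reflection is an involution (`creflectSite_creflectSite`). [cite: BalabanImbrieJaffe1985, (2.4) p.302] -/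
@[simp] theorem crefl_crefl (ρ : Fin P.d) (x : Balaban1983to89.Site P j) : crefl ρ (crefl ρ x) = x :=
  creflectSite_creflectSite ρ x

/-- The centre reflection is injective. [cite: BalabanImbrieJaffe1985, (2.4) p.302] -/
theorem crefl_inj (ρ : Fin P.d) {x x' : Balaban1983to89.Site P j} : crefl ρ x = crefl ρ x' ↔ x = x' := creflectSite_inj ρ

/-- The centre reflection as a bijection of the sites (its own inverse; `siteCreflectEquiv`). [cite: BalabanImbrieJaffe1985, (2.4) p.302] -/
def creflEquiv (ρ : Fin P.d) : Balaban1983to89.Site P j ≃ Balaban1983to89.Site P j := siteCreflectEquiv ρ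

/-- `creflEquiv` evaluated. [cite: BalabanImbrieJaffe1985, (2.4) p.302] -/
@[simp] theorem creflEquiv_apply (ρ : Fin P.d) (x : Balaban1983to89.Site P j) : creflEquiv ρ x = crefl ρ x := rfl

/-- `c_ρ(x + e_ρ) = c_ρx − e_ρ`: the reflected forward `ρ`-step is a backward step. [cite: BalabanImbrieJaffe1985, (2.4) p.302] -/
theorem crefl_shift_self (ρ : Fin P.d) (x : Balaban1983to89.Site P j) : crefl ρ (x.shift ρ) = (crefl ρ x).unshift ρ := by
  funext ν
  by_cases h : ν = ρ
  · subst h; simp [crefl_apply]; ring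
  · simp [crefl_apply, Site.shift_apply, Site.unshift_apply, h]

/-- `c_ρ(x − e_ρ) = c_ρx + e_ρ`. [cite: BalabanImbrieJaffe1985, (2.4) p.302] -/
theorem crefl_unshift_self (ρ : Fin P.d) (x : Balaban1983to89.Site P j) : crefl ρ (x.unshift ρ) = (crefl ρ x).shift ρ := by
  funext ν
  by_cases h : ν = ρ
  · subst h; simp [crefl_apply]
  · simp [crefl_apply, Site.shift_apply, Site.unshift_apply, h]

/-- `c_ρ` commutes with the unit steps in the other directions. [cite: BalabanImbrieJaffe1985, (2.4) p.302] -/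
theorem crefl_shift_of_ne (ρ : Fin P.d) (x : Balaban1983to89.Site P j) {μ : Fin P.d} (h : μ ≠ ρ) :
    crefl ρ (x.shift μ) = (crefl ρ x).shift μ := by
  funext ν
  by_cases h1 : ν = ρ
  · subst h1; simp [crefl_apply, Site.shift_apply, Ne.symm h]
  · by_cases h2 : ν = μ
    · subst h2; simp [crefl_apply, h1]
    · simp [crefl_apply, Site.shift_apply, h1, h2]

/-- … and with the backward unit steps in the other directions. [cite: BalabanImbrieJaffe1985, (2.4) p.302] -/
theorem crefl_unshift_of_ne (ρ : Fin P.d) (x : Balaban1983to89.Site P j) {μ : Fin P.d} (h : μ ≠ ρ) :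
    crefl ρ (x.unshift μ) = (crefl ρ x).unshift μ := by
  have h1 := crefl_shift_of_ne ρ (x.unshift μ) h
  rw [Site.shift_unshift] at h1
  rw [h1, Site.unshift_shift]

/-- The general shift: `c_ρ(x + e_μ)` is `c_ρx − e_ρ` or `c_ρx + e_μ`. [cite: BalabanImbrieJaffe1985, (2.4) p.302] -/
theorem crefl_shift (ρ : Fin P.d) (x : Balaban1983to89.Site P j) (μ : Fin P.d) :
    crefl ρ (x.shift μ) = if μ = ρ then (crefl ρ x).unshift ρ else (crefl ρ x).shift μ := by
  split_ifs with h
  · subst h; exact crefl_shift_self μ x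
  · exact crefl_shift_of_ne ρ x h

/-- **Blocks go to blocks** (`AveragingReflection.blockOf_creflect`): `blockOf (c_ρx) = c_ρ(blockOf x)`, the SAME formula one level up
(standing range). [cite: BalabanImbrieJaffe1985, (2.4) p.302] -/
theorem blockOf_crefl (hj : j + 1 ≤ P.m + P.K) (ρ : Fin P.d) (x : Balaban1983to89.Site P j) :
    blockOf (crefl ρ x) = crefl ρ (blockOf x) :=
  blockOf_creflect hj x ρ

/-- **Block centres go to block centres** (`T4Covariance.Site.emb_creflect`): `emb (c_ρy) = c_ρ(emb y)`. [cite: BalabanImbrieJaffe1985, (2.4) p.302] -/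
theorem emb_crefl (ρ : Fin P.d) (y : Balaban1983to89.Site P (j + 1)) : emb (crefl ρ y) = crefl ρ (emb y) :=
  Site.emb_creflect ρ y

/-- The offset flip `r_ρ ↦ L − 1 − r_ρ` of the block parametrisation `Site.blockSite`. [cite: BalabanImbrieJaffe1985, (2.4) p.302] -/
def flipOff (ρ : Fin P.d) (r : Fin P.d → Fin P.L) : Fin P.d → Fin P.L :=
  Function.update r ρ ⟨P.L - 1 - r ρ, by have := (r ρ).isLt; omega⟩

/-- `flipOff` coordinatewise. [cite: BalabanImbrieJaffe1985, (2.4) p.302] -/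
theorem flipOff_apply_val (ρ : Fin P.d) (r : Fin P.d → Fin P.L) (ν : Fin P.d) :
    ((flipOff ρ r ν : Fin P.L) : ℕ) = if ν = ρ then P.L - 1 - r ρ else r ν := by
  unfold flipOff
  by_cases h : ν = ρ
  · subst h; simp
  · simp [h]

/-- `flipOff` is an involution. [cite: BalabanImbrieJaffe1985, (2.4) p.302] -/
@[simp] theorem flipOff_flipOff (ρ : Fin P.d) (r : Fin P.d → Fin P.L) : flipOff ρ (flipOff ρ r) = r := by
  funext ν
  apply Fin.ext
  rw [flipOff_apply_val]
  by_cases h : ν = ρ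
  · subst h
    simp only [if_true, flipOff_apply_val]
    have := (r ν).isLt
    omega
  · rw [if_neg h, flipOff_apply_val, if_neg h]

/-- `flipOff` as a bijection of the offsets. [cite: BalabanImbrieJaffe1985, (2.4) p.302] -/
def flipOffEquiv (ρ : Fin P.d) : (Fin P.d → Fin P.L) ≃ (Fin P.d → Fin P.L) :=
  Function.Involutive.toPerm (flipOff (P := P) ρ) (flipOff_flipOff ρ)

/-- `flipOffEquiv` evaluated. [cite: BalabanImbrieJaffe1985, (2.4) p.302] -/
@[simp] theorem flipOffEquiv_apply (ρ : Fin P.d) (r : Fin P.d → Fin P.L) : flipOffEquiv ρ r = flipOff ρ r := rfl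

/-- **The points of a block go to the points of the reflected block, offset `ρ` flipped**: `c_ρ(blockSite y r) = blockSite (c_ρy)
(flipOff ρ r)` — label `N − 1 − (nL + r) = (N/L − 1 − n)L + (L − 1 − r)` (standing range). [cite: BalabanImbrieJaffe1985, (2.4) p.302] -/
theorem crefl_blockSite (hj : j + 1 ≤ P.m + P.K) (ρ : Fin P.d) (y : Balaban1983to89.Site P (j + 1)) (r : Fin P.d → Fin P.L) :
    crefl ρ (Site.blockSite y r) = Site.blockSite (crefl ρ y) (flipOff ρ r) := by
  funext ν
  by_cases h : ν = ρ
  · subst h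
    apply ZMod.val_injective
    have hL := P.hL.2
    have hN := P.sitesPerDir_eq_mul_succ hj
    have ha : (y ν).val < P.sitesPerDir (j + 1) := ZMod.val_lt _
    have hr := (r ν).isLt
    rw [crefl_apply, if_pos rfl, val_neg_sub_one, Site.val_blockSite hj, Site.val_blockSite hj, flipOff_apply_val, if_pos rfl,
      crefl_apply, if_pos rfl, val_neg_sub_one, hN]
    have h3 : (y ν).val * P.L + (r ν : ℕ) + 1 ≤ P.sitesPerDir (j + 1) * P.L := by nlinarith
    zify [h3, ha, hr, hL]
    have e1 : ((P.sitesPerDir (j + 1) * P.L - 1 - ((y ν).val * P.L + (r ν : ℕ)) : ℕ) : ℤ) =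
        (P.sitesPerDir (j + 1) : ℤ) * P.L - 1 - ((y ν).val * P.L + (r ν : ℕ)) := by omega
    have e2 : ((P.sitesPerDir (j + 1) - 1 - (y ν).val : ℕ) : ℤ) = (P.sitesPerDir (j + 1) : ℤ) - 1 - (y ν).val := by omega
    have e3 : ((P.L - 1 - (r ν : ℕ) : ℕ) : ℤ) = (P.L : ℤ) - 1 - (r ν : ℕ) := by omega
    rw [e1, e2, e3]
    ring
  · rw [crefl_apply, if_neg h]
    show _ = (((crefl ρ y ν).val * P.L + (flipOff ρ r ν : ℕ) : ℕ) : ZMod (P.sitesPerDir j))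
    rw [flipOff_apply_val, if_neg h, crefl_apply, if_neg h]
    rfl

/-- A straight run in a direction `μ ≠ ρ` is carried to the straight run from the image point. [cite: BalabanImbrieJaffe1985, (2.5) p.302] -/
theorem crefl_runSite_of_ne (ρ : Fin P.d) (x : Balaban1983to89.Site P j) {μ : Fin P.d} (h : μ ≠ ρ) (t : ℕ) :
    crefl ρ (runSite x μ t) = runSite (crefl ρ x) μ t := by
  induction t with
  | zero => simp
  | succ t ih => rw [runSite_succ, crefl_shift_of_ne ρ _ h, ih, runSite_succ]

/-- A straight `ρ`-run is carried to a BACKWARD run: `c_ρ(x + te_ρ) = c_ρx − te_ρ`. [cite: BalabanImbrieJaffe1985, (2.5) p.302] -/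
theorem crefl_runSite_self (ρ : Fin P.d) (x : Balaban1983to89.Site P j) (t : ℕ) :
    crefl ρ (runSite x ρ t) = Function.update (crefl ρ x) ρ (crefl ρ x ρ - t) := by
  funext ν
  rw [crefl_apply]
  by_cases h : ν = ρ
  · subst h
    simp only [if_true, Function.update_self, runSite, crefl_apply]
    ring
  · rw [if_neg h, Function.update_of_ne h, crefl_apply, if_neg h]
    simp [runSite, Function.update_of_ne h]

/-- The end point of the reflected backward run: `c_ρ(x + ne_ρ) + ne_ρ = c_ρ x`, i.e. `runSite (c_ρ(runSite x ρ n)) ρ n = c_ρ x`.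
[cite: BalabanImbrieJaffe1985, (2.5) p.302] -/
theorem runSite_crefl_runSite (ρ : Fin P.d) (x : Balaban1983to89.Site P j) (n : ℕ) :
    runSite (crefl ρ (runSite x ρ n)) ρ n = crefl ρ x := by
  rw [crefl_runSite_self]
  funext ν
  by_cases h : ν = ρ
  · subst h; simp [runSite]
  · simp [runSite, Function.update_of_ne h]

/-! ## §1  Bonds, plaquettes and the pull-backs of bond / site / plaquette functions -/

/-- The reflected positively oriented bond: a bond in a direction `μ ≠ ρ` goes to `⟨c_ρb₋, μ⟩`; the `ρ`-bond from `b₋` to `b₊` goes to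
the `ρ`-bond from `c_ρb₊` to `c_ρb₋ = c_ρb₊ + e_ρ`, which the reflected path traverses BACKWARDS. [cite: BalabanImbrieJaffe1985, (2.5) p.302] -/
def breflect (ρ : Fin P.d) (b : PBond P j) : PBond P j := ⟨if b.dir = ρ then crefl ρ b.tgt else crefl ρ b.src, b.dir⟩

/-- Direction of the reflected bond. [cite: BalabanImbrieJaffe1985, (2.5) p.302] -/
@[simp] theorem breflect_dir (ρ : Fin P.d) (b : PBond P j) : (breflect ρ b).dir = b.dir := rfl

/-- Source of the reflection of a `ρ`-bond: the image of its target. [cite: BalabanImbrieJaffe1985, (2.5) p.302] -/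
theorem breflect_src_of_eq (ρ : Fin P.d) (b : PBond P j) (h : b.dir = ρ) : (breflect ρ b).src = crefl ρ b.tgt := by
  simp [breflect, h]

/-- Source of the reflection of a bond in another direction: the image of its source. [cite: BalabanImbrieJaffe1985, (2.5) p.302] -/
theorem breflect_src_of_ne (ρ : Fin P.d) (b : PBond P j) (h : b.dir ≠ ρ) : (breflect ρ b).src = crefl ρ b.src := by
  simp [breflect, h]

/-- Target of the reflection of a `ρ`-bond: the image of its source. [cite: BalabanImbrieJaffe1985, (2.5) p.302] -/
theorem breflect_tgt_of_eq (ρ : Fin P.d) (b : PBond P j) (h : b.dir = ρ) : (breflect ρ b).tgt = crefl ρ b.src := by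
  rw [PBond.tgt, breflect_src_of_eq ρ b h, breflect_dir, h, PBond.tgt, h, crefl_shift_self, Site.shift_unshift]

/-- Target of the reflection of a bond in another direction: the image of its target. [cite: BalabanImbrieJaffe1985, (2.5) p.302] -/
theorem breflect_tgt_of_ne (ρ : Fin P.d) (b : PBond P j) (h : b.dir ≠ ρ) : (breflect ρ b).tgt = crefl ρ b.tgt := by
  rw [PBond.tgt, breflect_src_of_ne ρ b h, breflect_dir, PBond.tgt, crefl_shift_of_ne ρ _ h]

/-- The reflection of the bond `⟨x, μ⟩` for `μ ≠ ρ`. [cite: BalabanImbrieJaffe1985, (2.5) p.302] -/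
theorem breflect_mk_of_ne (ρ : Fin P.d) (x : Balaban1983to89.Site P j) {μ : Fin P.d} (h : μ ≠ ρ) :
    breflect ρ ⟨x, μ⟩ = ⟨crefl ρ x, μ⟩ := by
  simp [breflect, h]

/-- The reflection of the `ρ`-bond `⟨x, ρ⟩` is `⟨c_ρ(x + e_ρ), ρ⟩ = ⟨c_ρx − e_ρ, ρ⟩`. [cite: BalabanImbrieJaffe1985, (2.5) p.302] -/
theorem breflect_mk_self (ρ : Fin P.d) (x : Balaban1983to89.Site P j) :
    breflect ρ ⟨x, ρ⟩ = ⟨(crefl ρ x).unshift ρ, ρ⟩ := by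
  simp [breflect, PBond.tgt, crefl_shift_self]

/-- The bond reflection is an involution. [cite: BalabanImbrieJaffe1985, (2.5) p.302] -/
@[simp] theorem breflect_breflect (ρ : Fin P.d) (b : PBond P j) : breflect ρ (breflect ρ b) = b := by
  obtain ⟨x, μ⟩ := b
  by_cases h : μ = ρ
  · subst h
    rw [breflect_mk_self, breflect_mk_self, crefl_unshift_self, crefl_crefl, Site.unshift_shift]
  · rw [breflect_mk_of_ne ρ x h, breflect_mk_of_ne ρ _ h, crefl_crefl]

/-- The bond reflection as a bijection. [cite: BalabanImbrieJaffe1985, (2.5) p.302] -/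
def breflectEquiv (ρ : Fin P.d) : PBond P j ≃ PBond P j := Function.Involutive.toPerm (breflect ρ) (breflect_breflect ρ)

/-- `breflectEquiv` evaluated. [cite: BalabanImbrieJaffe1985, (2.5) p.302] -/
@[simp] theorem breflectEquiv_apply (ρ : Fin P.d) (b : PBond P j) : breflectEquiv ρ b = breflect ρ b := rfl

/-- The reflected positively oriented plaquette: same directions; base point `c_ρx` if `ρ` is not one of its directions, else
`c_ρ(x + e_ρ) = c_ρx − e_ρ` (the image square hangs on the negative `ρ`-side of `c_ρx`, with reversed orientation).
[cite: BalabanImbrieJaffe1985, (2.20) p.305] -/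
def preflect (ρ : Fin P.d) (p : Plaq P j) : Plaq P j :=
  ⟨if p.μ = ρ ∨ p.ν = ρ then crefl ρ (p.src.shift ρ) else crefl ρ p.src, p.μ, p.ν, p.hμν⟩

/-- The plaquette reflection is an involution. [cite: BalabanImbrieJaffe1985, (2.20) p.305] -/
@[simp] theorem preflect_preflect (ρ : Fin P.d) (p : Plaq P j) : preflect ρ (preflect ρ p) = p := by
  obtain ⟨x, a, b, hab⟩ := p
  simp only [preflect]
  split_ifs with h
  · simp [crefl_shift_self]
  · simp

/-- The plaquette reflection as a bijection. [cite: BalabanImbrieJaffe1985, (2.20) p.305] -/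
def preflectEquiv (ρ : Fin P.d) : Plaq P j ≃ Plaq P j := Function.Involutive.toPerm (preflect ρ) (preflect_preflect ρ)

/-- `preflectEquiv` evaluated. [cite: BalabanImbrieJaffe1985, (2.20) p.305] -/
@[simp] theorem preflectEquiv_apply (ρ : Fin P.d) (p : Plaq P j) : preflectEquiv ρ p = preflect ρ p := rfl

section Pullbacks

variable [AddCommGroup V]

/-- **The reflected bond field** `(c_ρA)(b) = ±A(c_ρb)`, sign `−1` on `ρ`-bonds (they are traversed backwards: `A_{⟨x,x′⟩} = −A_{⟨x′,x⟩}`,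
[Balaban1984PropagatorsI] p. 18). [cite: BalabanImbrieJaffe1985, (2.5) p.302] -/
def reflV (ρ : Fin P.d) (A : VecField P j V) : VecField P j V :=
  fun b => if b.dir = ρ then -A (breflect ρ b) else A (breflect ρ b)

/-- The reflected site function `(c_ρλ)(x) = λ(c_ρx)`. [cite: BalabanImbrieJaffe1985, (2.7) p.303] -/
def reflS (ρ : Fin P.d) (f : SiteField P j V) : SiteField P j V := fun x => f (crefl ρ x)

/-- **The reflected plaquette function** `(c_ρg)(p) = ±g(c_ρp)`, sign `−1` iff `ρ` is one of the directions of `p` (orientation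
reversed). [cite: BalabanImbrieJaffe1985, (2.20) p.305] -/
def reflP (ρ : Fin P.d) (g : Plaq P j → V) : Plaq P j → V :=
  fun p => if p.μ = ρ ∨ p.ν = ρ then -g (preflect ρ p) else g (preflect ρ p)

/-- `reflV` evaluated. [cite: BalabanImbrieJaffe1985, (2.5) p.302] -/
theorem reflV_apply (ρ : Fin P.d) (A : VecField P j V) (b : PBond P j) :
    reflV ρ A b = if b.dir = ρ then -A (breflect ρ b) else A (breflect ρ b) := rfl

omit [AddCommGroup V] in
/-- `reflS` evaluated. [cite: BalabanImbrieJaffe1985, (2.7) p.303] -/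
@[simp] theorem reflS_apply (ρ : Fin P.d) (f : SiteField P j V) (x : Balaban1983to89.Site P j) : reflS ρ f x = f (crefl ρ x) := rfl

/-- `reflP` evaluated. [cite: BalabanImbrieJaffe1985, (2.20) p.305] -/
theorem reflP_apply (ρ : Fin P.d) (g : Plaq P j → V) (p : Plaq P j) :
    reflP ρ g p = if p.μ = ρ ∨ p.ν = ρ then -g (preflect ρ p) else g (preflect ρ p) := rfl

/-- `reflV` on a bond `⟨x, μ⟩`, `μ ≠ ρ`. [cite: BalabanImbrieJaffe1985, (2.5) p.302] -/
theorem reflV_mk_of_ne (ρ : Fin P.d) (A : VecField P j V) (x : Balaban1983to89.Site P j) {μ : Fin P.d} (h : μ ≠ ρ) :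
    reflV ρ A ⟨x, μ⟩ = A ⟨crefl ρ x, μ⟩ := by
  rw [reflV_apply, if_neg (show (⟨x, μ⟩ : PBond P j).dir ≠ ρ from h), breflect_mk_of_ne ρ x h]

/-- `reflV` on the `ρ`-bond `⟨x, ρ⟩`: `−A⟨c_ρx − e_ρ, ρ⟩`. [cite: BalabanImbrieJaffe1985, (2.5) p.302] -/
theorem reflV_mk_self (ρ : Fin P.d) (A : VecField P j V) (x : Balaban1983to89.Site P j) :
    reflV ρ A ⟨x, ρ⟩ = -A ⟨(crefl ρ x).unshift ρ, ρ⟩ := by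
  rw [reflV_apply, if_pos (show (⟨x, ρ⟩ : PBond P j).dir = ρ from rfl), breflect_mk_self]

/-- `reflV` is an involution. [cite: BalabanImbrieJaffe1985, (2.5) p.302] -/
@[simp] theorem reflV_reflV (ρ : Fin P.d) (A : VecField P j V) : reflV ρ (reflV ρ A) = A := by
  funext b
  rw [reflV_apply]
  split_ifs with h
  · rw [reflV_apply, if_pos (by rw [breflect_dir]; exact h), breflect_breflect, neg_neg]
  · rw [reflV_apply, if_neg (by rw [breflect_dir]; exact h), breflect_breflect]

omit [AddCommGroup V] in
/-- `reflS` is an involution. [cite: BalabanImbrieJaffe1985, (2.7) p.303] -/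
@[simp] theorem reflS_reflS (ρ : Fin P.d) (f : SiteField P j V) : reflS ρ (reflS ρ f) = f := by
  funext x; simp

/-- `reflP` is an involution. [cite: BalabanImbrieJaffe1985, (2.20) p.305] -/
@[simp] theorem reflP_reflP (ρ : Fin P.d) (g : Plaq P j → V) : reflP ρ (reflP ρ g) = g := by
  funext p
  rw [reflP_apply]
  have hd : (preflect ρ p).μ = p.μ ∧ (preflect ρ p).ν = p.ν := ⟨rfl, rfl⟩
  split_ifs with h
  · rw [reflP_apply, hd.1, hd.2, if_pos h, preflect_preflect, neg_neg]
  · rw [reflP_apply, hd.1, hd.2, if_neg h, preflect_preflect]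

/-- `reflV` is injective: `c_ρA = 0 ↔ A = 0`. [cite: BalabanImbrieJaffe1985, (2.5) p.302] -/
theorem reflV_eq_zero_iff (ρ : Fin P.d) (A : VecField P j V) : reflV ρ A = 0 ↔ A = 0 := by
  constructor
  · intro h
    have h2 := reflV_reflV ρ A
    rw [h] at h2
    rw [← h2]
    funext b
    simp [reflV_apply]
  · rintro rfl
    funext b
    simp [reflV_apply]

/-- `reflV 0 = 0`. [cite: BalabanImbrieJaffe1985, (2.5) p.302] -/
@[simp] theorem reflV_zero (ρ : Fin P.d) : reflV ρ (0 : VecField P j V) = 0 := (reflV_eq_zero_iff ρ 0).2 rfl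

/-- `reflV` is additive. [cite: BalabanImbrieJaffe1985, (2.5) p.302] -/
theorem reflV_add (ρ : Fin P.d) (A B : VecField P j V) : reflV ρ (A + B) = reflV ρ A + reflV ρ B := by
  funext b
  simp only [reflV_apply, Pi.add_apply]
  split_ifs <;> abel

/-- `reflV` commutes with negation. [cite: BalabanImbrieJaffe1985, (2.5) p.302] -/
theorem reflV_neg (ρ : Fin P.d) (A : VecField P j V) : reflV ρ (-A) = -reflV ρ A := by
  funext b
  simp only [reflV_apply, Pi.neg_apply]
  split_ifs <;> abel

/-- `reflV` is subtractive. [cite: BalabanImbrieJaffe1985, (2.5) p.302] -/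
theorem reflV_sub (ρ : Fin P.d) (A B : VecField P j V) : reflV ρ (A - B) = reflV ρ A - reflV ρ B := by
  rw [sub_eq_add_neg, reflV_add, reflV_neg, ← sub_eq_add_neg]

/-- `reflV` is homogeneous. [cite: BalabanImbrieJaffe1985, (2.5) p.302] -/
theorem reflV_smul [Module ℝ V] (ρ : Fin P.d) (c : ℝ) (A : VecField P j V) : reflV ρ (c • A) = c • reflV ρ A := by
  funext b
  simp only [reflV_apply, Pi.smul_apply]
  split_ifs
  · rw [smul_neg]
  · rfl

/-- `reflS` is additive. [cite: BalabanImbrieJaffe1985, (2.7) p.303] -/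
theorem reflS_add (ρ : Fin P.d) (f g : SiteField P j V) : reflS ρ (f + g) = reflS ρ f + reflS ρ g := rfl

/-- `reflS` is homogeneous. [cite: BalabanImbrieJaffe1985, (2.7) p.303] -/
theorem reflS_smul [Module ℝ V] (ρ : Fin P.d) (c : ℝ) (f : SiteField P j V) : reflS ρ (c • f) = c • reflS ρ f := rfl

/-- `reflP` is additive. [cite: BalabanImbrieJaffe1985, (2.20) p.305] -/
theorem reflP_add (ρ : Fin P.d) (f g : Plaq P j → V) : reflP ρ (f + g) = reflP ρ f + reflP ρ g := by
  funext p
  simp only [reflP_apply, Pi.add_apply]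
  split_ifs <;> abel

/-- `reflP` is homogeneous. [cite: BalabanImbrieJaffe1985, (2.20) p.305] -/
theorem reflP_smul [Module ℝ V] (ρ : Fin P.d) (c : ℝ) (g : Plaq P j → V) : reflP ρ (c • g) = c • reflP ρ g := by
  funext p
  simp only [reflP_apply, Pi.smul_apply]
  split_ifs
  · rw [smul_neg]
  · rfl

/-- `reflP` is injective: `c_ρg = 0 ↔ g = 0`. [cite: BalabanImbrieJaffe1985, (2.20) p.305] -/
theorem reflP_eq_zero_iff (ρ : Fin P.d) (g : Plaq P j → V) : reflP ρ g = 0 ↔ g = 0 := by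
  constructor
  · intro h
    have h2 := reflP_reflP ρ g
    rw [h] at h2
    rw [← h2]
    funext p
    simp [reflP_apply]
  · rintro rfl
    funext p
    simp [reflP_apply]

end Pullbacks

/-! ## §2  Covariance of the lattice calculus `∂` (gradient), `∂*`, `Δ`, `∂` (curl) -/

section Calculus

variable [AddCommGroup V] [Module ℝ V]

/-- **The gradient is covariant**: `∂(c_ρλ) = c_ρ(∂λ)`. [cite: BalabanImbrieJaffe1985, (2.7) p.303] -/
theorem grad_reflS (ρ : Fin P.d) (c : ℝ) (f : SiteField P j V) : grad c (reflS ρ f) = reflV ρ (grad c f) := by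
  funext b
  obtain ⟨x, μ⟩ := b
  by_cases h : μ = ρ
  · subst h
    rw [reflV_mk_self]
    simp only [grad, reflS_apply, PBond.tgt, Site.shift_unshift, crefl_shift_self, smul_sub, neg_sub]
  · rw [reflV_mk_of_ne ρ _ x h]
    simp only [grad, reflS_apply, PBond.tgt, crefl_shift_of_ne ρ x h]

/-- **The divergence is covariant**: `∂*(c_ρA) = c_ρ(∂*A)`. [cite: BalabanImbrieJaffe1985, (4.4.1) p.311] -/
theorem diverg_reflV (ρ : Fin P.d) (c : ℝ) (A : VecField P j V) : diverg c (reflV ρ A) = reflS ρ (diverg c A) := by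
  funext x
  simp only [diverg, reflS_apply]
  refine Finset.sum_congr rfl fun μ _ => ?_
  by_cases h : μ = ρ
  · subst h
    rw [reflV_mk_self μ A (x.unshift μ), reflV_mk_self μ A x, crefl_unshift_self, Site.unshift_shift]
    congr 1
    abel
  · rw [reflV_mk_of_ne ρ A _ h, reflV_mk_of_ne ρ A _ h, crefl_unshift_of_ne ρ x h]

/-- **The Laplacian is covariant**: `Δ(c_ρλ) = c_ρ(Δλ)`. [cite: BalabanImbrieJaffe1985, (4.4.1) p.311] -/
theorem laplace_reflS (ρ : Fin P.d) (c : ℝ) (f : SiteField P j V) : laplace c (reflS ρ f) = reflS ρ (laplace c f) := by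
  funext x
  simp only [laplace, reflS_apply]
  refine Finset.sum_congr rfl fun μ _ => ?_
  by_cases h : μ = ρ
  · subst h
    simp only [crefl_shift_self, crefl_unshift_self]
    module
  · simp only [crefl_shift_of_ne ρ x h, crefl_unshift_of_ne ρ x h]

/-- Unit steps in different directions, one forward one backward, commute. [folklore] -/
private theorem unshift_shift_comm (x : Balaban1983to89.Site P j) {a b : Fin P.d} (h : b ≠ a) :
    (x.shift b).unshift a = (x.unshift a).shift b := by
  funext ν
  by_cases h1 : ν = a
  · subst h1; simp [Site.shift_apply, Ne.symm h]
  · by_cases h2 : ν = b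
    · subst h2; simp [Site.unshift_apply, h1]
    · simp [Site.shift_apply, Site.unshift_apply, h1, h2]

/-- **The curl is covariant**: `(∂(c_ρA))(p) = ±(∂A)(c_ρp)` with the plaquette sign, i.e. `curl c (reflV ρ A) = reflP ρ (curl c A)` —
the plaquette variable is reversed together with the orientation of the plaquette. [cite: BalabanImbrieJaffe1985, (4.2.2) p.310] -/
theorem curl_reflV (ρ : Fin P.d) (c : ℝ) (A : VecField P j V) : curl c (reflV ρ A) = reflP ρ (curl c A) := by
  funext p
  obtain ⟨x, a, b, hab⟩ := p
  rw [reflP_apply]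
  simp only [curl, preflect]
  by_cases ha : a = ρ
  · subst ha
    have hb : b ≠ a := fun h => absurd hab (by rw [h]; exact lt_irrefl _)
    have f1 : (crefl a x).unshift a = crefl a (x.shift a) := (crefl_shift_self a x).symm
    have f2 : crefl a x = (crefl a (x.shift a)).shift a := by rw [crefl_shift_self, Site.shift_unshift]
    have f3 : (crefl a (x.shift b)).unshift a = (crefl a (x.shift a)).shift b := by
      rw [crefl_shift_of_ne a x hb, unshift_shift_comm _ hb, f1]
    simp only [true_or, if_true]
    rw [reflV_mk_self a A x, reflV_mk_self a A (x.shift b), reflV_mk_of_ne a A (x.shift a) hb, reflV_mk_of_ne a A x hb,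
      f1, f3, f2]
    module
  · by_cases hb : b = ρ
    · subst hb
      have f1 : (crefl b x).unshift b = crefl b (x.shift b) := (crefl_shift_self b x).symm
      have f2 : crefl b x = (crefl b (x.shift b)).shift b := by rw [crefl_shift_self, Site.shift_unshift]
      have f3 : (crefl b (x.shift a)).unshift b = (crefl b (x.shift b)).shift a := by
        rw [crefl_shift_of_ne b x ha, unshift_shift_comm _ ha, f1]
      simp only [or_true, if_true]
      rw [reflV_mk_of_ne b A x ha, reflV_mk_self b A (x.shift a), reflV_mk_of_ne b A (x.shift b) ha, reflV_mk_self b A x,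
        f1, f3, f2]
      module
    · simp only [ha, hb, or_self, if_false]
      rw [reflV_mk_of_ne ρ A _ ha, reflV_mk_of_ne ρ A _ hb, reflV_mk_of_ne ρ A _ ha, reflV_mk_of_ne ρ A _ hb,
        crefl_shift_of_ne ρ _ ha, crefl_shift_of_ne ρ _ hb]

end Calculus

/-! ## §3  One level: straight runs, staircases, the centred axial gauge, the averages `Q`, `Q′` -/

section OneLevel

variable [AddCommGroup V]

/-- one more step of a signed straight run adds the next bond, for every `n ∈ ℤ` (private copy of the tree's `runSum_add_one`).
[folklore] -/
private theorem runSum_add_one' (A : VecField P j V) (x : Balaban1983to89.Site P j) (μ : Fin P.d) (n : ℤ) :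
    runSum A x μ (n + 1) = runSum A x μ n + A ⟨Function.update x μ (x μ + (n : ZMod (P.sitesPerDir j))), μ⟩ := by
  cases n with
  | ofNat k =>
    rw [Int.ofNat_eq_natCast, ← Nat.cast_succ, runSum_ofNat, runSum_ofNat, segSum, segSum, Finset.sum_range_succ, Int.cast_natCast]
    rfl
  | negSucc k =>
    have hk : runSum A x μ (Int.negSucc k) =
        -∑ t ∈ Finset.range (k + 1), A ⟨Function.update x μ (x μ - ((t + 1 : ℕ) : ZMod (P.sitesPerDir j))), μ⟩ := rfl
    cases k with
    | zero =>
      have e : Int.negSucc 0 + 1 = 0 := by decide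
      rw [e, runSum_zero, hk, Int.cast_negSucc, ← sub_eq_add_neg, Finset.sum_range_succ, Finset.sum_range_zero, zero_add,
        neg_add_cancel]
    | succ k =>
      have hk' : runSum A x μ (Int.negSucc k) =
          -∑ t ∈ Finset.range (k + 1), A ⟨Function.update x μ (x μ - ((t + 1 : ℕ) : ZMod (P.sitesPerDir j))), μ⟩ := rfl
      have e : Int.negSucc (k + 1) + 1 = Int.negSucc k := by
        rw [Int.negSucc_eq, Int.negSucc_eq]; push_cast; ring
      rw [e, hk', hk, Int.cast_negSucc, ← sub_eq_add_neg, Finset.sum_range_succ _ (k + 1)]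
      abel

/-- `A([x, x + ne_μ])` of the reflected field, `μ ≠ ρ`: the run from the image point. [cite: BalabanImbrieJaffe1985, (2.5) p.302] -/
theorem segSum_reflV_of_ne (ρ : Fin P.d) (A : VecField P j V) (x : Balaban1983to89.Site P j) {μ : Fin P.d} (h : μ ≠ ρ) (n : ℕ) :
    segSum (reflV ρ A) x μ n = segSum A (crefl ρ x) μ n := by
  unfold segSum
  refine Finset.sum_congr rfl fun t _ => ?_
  rw [runBond, runBond, reflV_mk_of_ne ρ A _ h, crefl_runSite_of_ne ρ x h]

/-- a `μ`-step of the base point commutes with `c_ρ`, `μ ≠ ρ` (signed steps). [folklore] -/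
private theorem crefl_update_of_ne (ρ : Fin P.d) (x : Balaban1983to89.Site P j) {μ : Fin P.d} (h : μ ≠ ρ)
    (m : ZMod (P.sitesPerDir j)) :
    crefl ρ (Function.update x μ (x μ + m)) = Function.update (crefl ρ x) μ (crefl ρ x μ + m) := by
  funext ν
  rw [crefl_apply]
  by_cases h1 : ν = ρ
  · subst h1; simp [crefl_apply, Ne.symm h]
  · by_cases h2 : ν = μ
    · subst h2; simp [crefl_apply, h1]
    · simp [h1, h2, crefl_apply]

/-- a signed `ρ`-step of the base point is reversed by `c_ρ`: `c_ρ(x + m e_ρ) − e_ρ = c_ρx − (m+1)e_ρ`. [folklore] -/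
private theorem crefl_update_self_unshift (ρ : Fin P.d) (x : Balaban1983to89.Site P j) (m : ℤ) :
    (crefl ρ (Function.update x ρ (x ρ + (m : ZMod (P.sitesPerDir j))))).unshift ρ =
      Function.update (crefl ρ x) ρ (crefl ρ x ρ + ((-m - 1 : ℤ) : ZMod (P.sitesPerDir j))) := by
  funext ν
  rw [Site.unshift_apply, crefl_apply]
  by_cases h1 : ν = ρ
  · subst h1; simp [crefl_apply]; ring
  · simp [h1, crefl_apply]

/-- The signed run of the reflected field in a direction `μ ≠ ρ`. [cite: BalabanImbrieJaffe1985, (2.5) p.302] -/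
theorem runSum_reflV_of_ne (ρ : Fin P.d) (A : VecField P j V) (x : Balaban1983to89.Site P j) {μ : Fin P.d} (h : μ ≠ ρ) (n : ℤ) :
    runSum (reflV ρ A) x μ n = runSum A (crefl ρ x) μ n := by
  induction n using Int.induction_on with
  | zero => simp
  | succ n ih =>
    rw [runSum_add_one', runSum_add_one', ih, reflV_mk_of_ne ρ A _ h, crefl_update_of_ne ρ x h]
  | pred n ih =>
    have e1 := runSum_add_one' (reflV ρ A) x μ (-(n : ℤ) - 1)
    have e2 := runSum_add_one' A (crefl ρ x) μ (-(n : ℤ) - 1)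
    rw [sub_add_cancel] at e1 e2
    rw [reflV_mk_of_ne ρ A _ h, crefl_update_of_ne ρ x h] at e1
    have h3 := ih
    rw [e1, e2] at h3
    exact add_right_cancel h3

/-- **A reflected `ρ`-run is the reversed run**: `(c_ρA)(signed run of n steps from x) = A(signed run of −n steps from c_ρx)`.
[cite: BalabanImbrieJaffe1985, (2.5) p.302] -/
theorem runSum_reflV_self (ρ : Fin P.d) (A : VecField P j V) (x : Balaban1983to89.Site P j) (n : ℤ) :
    runSum (reflV ρ A) x ρ n = runSum A (crefl ρ x) ρ (-n) := by
  induction n using Int.induction_on with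
  | zero => simp
  | succ n ih =>
    have e2 := runSum_add_one' A (crefl ρ x) ρ (-(n : ℤ) - 1)
    rw [sub_add_cancel] at e2
    rw [runSum_add_one', ih, e2, reflV_mk_self, crefl_update_self_unshift, show (-((n : ℤ) + 1) : ℤ) = -(n : ℤ) - 1 by ring]
    abel
  | pred n ih =>
    rw [neg_neg] at ih
    have e1 := runSum_add_one' (reflV ρ A) x ρ (-(n : ℤ) - 1)
    rw [sub_add_cancel, reflV_mk_self, crefl_update_self_unshift, show (-(-(n : ℤ) - 1) - 1 : ℤ) = (n : ℤ) by ring] at e1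
    rw [show (-(-(n : ℤ) - 1) : ℤ) = (n : ℤ) + 1 by ring, runSum_add_one', ← ih, e1]
    abel

/-- **A reflected straight `ρ`-run of `n` bonds is the reversed run from the image of its end point**:
`(c_ρA)([x, x + ne_ρ]) = −A([c_ρ(x + ne_ρ), c_ρ(x + ne_ρ) + ne_ρ])`. [cite: BalabanImbrieJaffe1985, (2.5) p.302] -/
theorem segSum_reflV_self (ρ : Fin P.d) (A : VecField P j V) (x : Balaban1983to89.Site P j) (n : ℕ) :
    segSum (reflV ρ A) x ρ n = -segSum A (crefl ρ (runSite x ρ n)) ρ n := by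
  unfold segSum
  rw [← Finset.sum_neg_distrib, ← Finset.sum_range_reflect (fun t => -A (runBond (crefl ρ (runSite x ρ n)) ρ t)) n]
  refine Finset.sum_congr rfl fun t ht => ?_
  have htn : t < n := Finset.mem_range.1 ht
  have hs : (crefl ρ (runSite x ρ t)).unshift ρ = runSite (crefl ρ (runSite x ρ n)) ρ (n - 1 - t) := by
    funext ν
    rw [Site.unshift_apply, crefl_runSite_self, crefl_runSite_self]
    by_cases h1 : ν = ρ
    · subst h1
      simp only [if_true, Function.update_self, runSite]
      have hc : ((n - 1 - t : ℕ) : ZMod (P.sitesPerDir j)) = (n : ZMod (P.sitesPerDir j)) - 1 - t := by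
        rw [Nat.cast_sub (by omega), Nat.cast_sub (by omega), Nat.cast_one]
      rw [hc]; ring
    · simp [h1, runSite]
  simp only [runBond, reflV_mk_self, hs]

/-- The corners of the staircase reflect: `mixSite μ (c_ρy) (c_ρx) = c_ρ(mixSite μ y x)`. [cite: BalabanImbrieJaffe1985, (3.4) p.306] -/
theorem crefl_mixSite (ρ μ : Fin P.d) (y x : Balaban1983to89.Site P j) : crefl ρ (mixSite μ y x) = mixSite μ (crefl ρ y) (crefl ρ x) := by
  funext ν
  by_cases h1 : ν = ρ
  · subst h1
    simp only [crefl_apply, mixSite, if_true]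
    split_ifs <;> rfl
  · simp [mixSite, crefl_apply, h1]

/-- negation commutes with the centred residue off the antipode (private copy of r09's helper). [folklore] -/
private theorem valMinAbs_neg_of_two_mul_natAbs_lt {n : ℕ} (a : ZMod n) (h : 2 * a.valMinAbs.natAbs < n) :
    (-a).valMinAbs = -a.valMinAbs := by
  apply ZMod.valMinAbs_neg_of_ne_half
  intro h2
  have h3 : a.valMinAbs * 2 = n := (ZMod.valMinAbs_mul_two_eq_iff a).2 h2
  have h4 : (2 * a.valMinAbs.natAbs : ℤ) = n := by
    rw [Int.natCast_natAbs, abs_of_nonneg (by omega)]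
    omega
  omega

/-- **The staircase contours reflect**: `(c_ρA)(Γ_{y,x}) = A(Γ_{c_ρy, c_ρx})` for `x` off the `ρ`-antipode of `y` (the `ρ`-run is reversed
and the signed displacement is negated; the other runs are carried along). [cite: BalabanImbrieJaffe1985, (3.4) p.306] -/
theorem stairSum_reflV (ρ : Fin P.d) (A : VecField P j V) (y x : Balaban1983to89.Site P j)
    (h : 2 * ((x ρ - y ρ).valMinAbs).natAbs < P.sitesPerDir j) :
    stairSum (reflV ρ A) y x = stairSum A (crefl ρ y) (crefl ρ x) := by
  unfold stairSum
  refine Finset.sum_congr rfl fun μ _ => ?_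
  by_cases hμ : μ = ρ
  · subst hμ
    rw [runSum_reflV_self, crefl_mixSite, ← valMinAbs_neg_of_two_mul_natAbs_lt _ h]
    congr 2
    rw [crefl_apply, crefl_apply, if_pos rfl, if_pos rfl]
    ring
  · rw [runSum_reflV_of_ne ρ A _ hμ, crefl_mixSite]
    congr 2
    rw [crefl_apply, crefl_apply, if_neg hμ, if_neg hμ]

/-- On the points of `B(y)` the antipode condition relative to the block centre holds (`|x_ρ − (emb y)_ρ| ≤ (L−1)/2 < N_j/2`,
standing range). [cite: BalabanImbrieJaffe1985, (3.4) p.306] -/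
theorem two_mul_natAbs_valMinAbs_blockSite_lt (hj : j + 1 ≤ P.m + P.K) (ρ : Fin P.d) (y : Balaban1983to89.Site P (j + 1))
    (r : Fin P.d → Fin P.L) : 2 * ((Site.blockSite y r ρ - emb y ρ).valMinAbs).natAbs < P.sitesPerDir j := by
  have h1 : (Site.blockSite y r ρ - emb y ρ).valMinAbs = BlockAveraging.off r ρ :=
    congrFun (BlockAveragingTwoLevel.offsetOf_blockSite hj y r) ρ
  rw [h1]
  have hb := BlockAveraging.off_bounds r ρ
  have hL := AveragingRT.two_mul_half_add_one P
  have hN : P.L ≤ P.sitesPerDir j := by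
    rw [P.sitesPerDir_eq_mul_succ hj]
    exact Nat.le_mul_of_pos_left P.L (Nat.pos_of_ne_zero (P.sitesPerDir_ne_zero (j + 1)))
  omega

/-- **The centred axial gauge is reflection invariant**: `c_ρA` is axial iff `A` is — the trees of (3.4)/(4.1.2) in the tree's centred
convention (`LatticeFieldCalculus.IsAxial`: all `μ`-runs whose lower coordinates sit at the block centre) are carried to trees
(`emb (c_ρy) = c_ρ(emb y)`, `c_ρ(blockSite y r) = blockSite (c_ρy) (flipOff ρ r)`; standing range). [cite: BalabanImbrieJaffe1985, (3.4) p.306] -/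
theorem isAxial_reflV_iff (hj : j + 1 ≤ P.m + P.K) (ρ : Fin P.d) (A : VecField P j V) : IsAxial (reflV ρ A) ↔ IsAxial A := by
  have key : ∀ (y : Balaban1983to89.Site P (j + 1)) (r : Fin P.d → Fin P.L),
      stairSum (reflV ρ A) (emb y) (Site.blockSite y r) = stairSum A (emb (crefl ρ y)) (Site.blockSite (crefl ρ y) (flipOff ρ r)) := by
    intro y r
    rw [stairSum_reflV ρ A _ _ (two_mul_natAbs_valMinAbs_blockSite_lt hj ρ y r), emb_crefl, crefl_blockSite hj]
  have key2 : ∀ (y : Balaban1983to89.Site P (j + 1)) (r : Fin P.d → Fin P.L),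
      Site.blockSite (crefl ρ y) (flipOff ρ r) ≠ emb (crefl ρ y) ↔ Site.blockSite y r ≠ emb y := by
    intro y r
    rw [← crefl_blockSite hj, emb_crefl]
    exact (crefl_inj ρ).not
  unfold IsAxial
  constructor
  · intro h y r hne
    have h' := h (crefl ρ y) (flipOff ρ r) (by rw [← key2, crefl_crefl, flipOff_flipOff]; exact hne)
    rwa [key, crefl_crefl, flipOff_flipOff] at h'
  · intro h y r hne
    rw [key]
    exact h _ _ ((key2 y r).2 hne)

variable [Module ℝ V]

/-- **`Q` commutes with the reflections**: `Q(c_ρA) = c_ρ(QA)` — the straight-line bond average (2.13) (tree `bondAvg`) of the reflected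
field is the reflected average, the SAME reflection one level up (blocks go to blocks; a `ρ`-line of `B(y)` goes, reversed, to the
`ρ`-line of the reflected block of `y + e_ρ`; standing range). [cite: BalabanImbrieJaffe1985, (2.13) p.304] -/
theorem bondAvg_reflV (hj : j + 1 ≤ P.m + P.K) (ρ : Fin P.d) (A : VecField P j V) :
    bondAvg (reflV ρ A) = reflV ρ (bondAvg A) := by
  funext c
  obtain ⟨y, μ⟩ := c
  by_cases h : μ = ρ
  · subst h
    rw [reflV_mk_self, ← crefl_shift_self]
    simp only [bondAvg]
    rw [← smul_neg, ← Finset.sum_neg_distrib]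
    congr 1
    rw [← (flipOffEquiv (P := P) μ).sum_comp]
    refine Finset.sum_congr rfl fun r _ => ?_
    rw [flipOffEquiv_apply, segSum_reflV_self, runSite_blockSite_L hj, crefl_blockSite hj, flipOff_flipOff]
  · rw [reflV_mk_of_ne ρ _ y h]
    simp only [bondAvg]
    congr 1
    rw [← (flipOffEquiv (P := P) ρ).sum_comp]
    refine Finset.sum_congr rfl fun r _ => ?_
    rw [flipOffEquiv_apply, segSum_reflV_of_ne ρ A _ h, crefl_blockSite hj, flipOff_flipOff]

/-- `Q′` commutes with the reflections: `Q′(c_ρλ) = c_ρ(Q′λ)` (ordinary block average of site functions; standing range).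
[cite: BalabanImbrieJaffe1985, (2.6) p.303] -/
theorem siteAvg_reflS (hj : j + 1 ≤ P.m + P.K) (ρ : Fin P.d) (f : SiteField P j V) :
    siteAvg (reflS ρ f) = reflS ρ (siteAvg f) := by
  funext y
  simp only [siteAvg, reflS_apply]
  congr 1
  rw [← (flipOffEquiv (P := P) ρ).sum_comp]
  refine Finset.sum_congr rfl fun r _ => ?_
  rw [flipOffEquiv_apply, crefl_blockSite hj, flipOff_flipOff]

end OneLevel

/-! ## §4  k levels: `Q_k`, `Q′_k`, `δ_{k,Ax}` and the support of (4.1.1) under the reflections -/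

section Iterated

variable [AddCommGroup V] [Module ℝ V]

/-- **`Q_k` commutes with the reflections** (the same `c_ρ` at every level; induction on k, standing range `k ≤ m + K`).
[cite: BalabanImbrieJaffe1985, (2.13) p.304] -/
theorem bondAvgIter_reflV (ρ : Fin P.d) : ∀ (k : ℕ), k ≤ P.m + P.K → ∀ (A : VecField P 0 V),
    bondAvgIter k (reflV ρ A) = reflV ρ (bondAvgIter k A)
  | 0, _, _ => rfl
  | k + 1, hk, A => by
    show bondAvg (bondAvgIter k (reflV ρ A)) = reflV ρ (bondAvg (bondAvgIter k A))
    rw [bondAvgIter_reflV ρ k (by omega) A, bondAvg_reflV (by omega)]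

/-- `Q′_k` commutes with the reflections (standing range). [cite: BalabanImbrieJaffe1985, (2.6) p.303] -/
theorem siteAvgIter_reflS (ρ : Fin P.d) : ∀ (k : ℕ), k ≤ P.m + P.K → ∀ (f : SiteField P 0 V),
    siteAvgIter k (reflS ρ f) = reflS ρ (siteAvgIter k f)
  | 0, _, _ => rfl
  | k + 1, hk, f => by
    show siteAvg (siteAvgIter k (reflS ρ f)) = reflS ρ (siteAvg (siteAvgIter k f))
    rw [siteAvgIter_reflS ρ k (by omega) f, siteAvg_reflS (by omega)]

/-- **`δ_{k,Ax}` is reflection invariant**: every factor `δ_{Ax}(Q_jA)`, `j < k`, of (4.1.2) is (standing range).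
[cite: BalabanImbrieJaffe1985, (4.1.2) p.309] -/
theorem deltaAx_reflV_iff (ρ : Fin P.d) : ∀ (k : ℕ), k ≤ P.m + P.K → ∀ (A : VecField P 0 V),
    deltaAx k (reflV ρ A) ↔ deltaAx k A
  | 0, _, A => iff_of_true (deltaAx_zero _) (deltaAx_zero A)
  | k + 1, hk, A => by
    rw [deltaAx_succ, deltaAx_succ, deltaAx_reflV_iff ρ k (by omega) A, bondAvgIter_reflV ρ k (by omega) A,
      isAxial_reflV_iff (by omega)]

/-- **The support `δ(Q_kA)δ_{k,Ax}(A)` of (4.1.1) is reflection invariant**: `c_ρA ∈ constraint411 k ↔ A ∈ constraint411 k` (standing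
range). [cite: BalabanImbrieJaffe1985, (4.1.1) p.309] -/
theorem constraint411_reflV_iff (ρ : Fin P.d) {k : ℕ} (hk : k ≤ P.m + P.K) (A : VecField P 0 V) :
    reflV ρ A ∈ (constraint411 k : Submodule ℝ (VecField P 0 V)) ↔ A ∈ (constraint411 k : Submodule ℝ (VecField P 0 V)) := by
  rw [mem_constraint411, mem_constraint411, bondAvgIter_reflV ρ k hk, deltaAx_reflV_iff ρ k hk, reflV_eq_zero_iff]

end Iterated

/-! ## §5  The edge sets `B^e(p′)`, the pull-back `Q^{e*}` (2.22) and its composite `Q^{e*}_k` (2.24) -/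

/-- every fine site is a block point of its block (standing range). [folklore] -/
private theorem exists_eq_blockSite' (hj : j + 1 ≤ P.m + P.K) (x : Balaban1983to89.Site P j) :
    ∃ r : Fin P.d → Fin P.L, x = Site.blockSite (blockOf x) r :=
  ⟨Site.blockEquiv hj (blockOf x) ⟨x, rfl⟩, (congrArg Subtype.val ((Site.blockEquiv hj (blockOf x)).left_inv ⟨x, rfl⟩)).symm⟩

/-- **Membership in the edge sets `B^e(p′)` (2.21) of p31's torus geometry is reflection covariant**: `c_ρp ∈ B^e(c_ρp′) ↔ p ∈ B^e(p′)`
(blocks go to blocks; the top corner cell of a block in the direction `ρ` goes to the top corner cell of the reflected block; standing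
range). [cite: BalabanImbrieJaffe1985, (2.21) p.305] -/
theorem mem_edgeB_preflect_iff (hd : 2 ≤ P.d) (hj : j + 1 ≤ P.m + P.K) (ρ : Fin P.d) (p' : Plaq P (j + 1)) (p : Plaq P j) :
    preflect ρ p ∈ (BIJ85CurlQsstar.torusEdgeCells P j hd).B (preflect ρ p') ↔ p ∈ (BIJ85CurlQsstar.torusEdgeCells P j hd).B p' := by
  obtain ⟨x, μ, ν, hμν⟩ := p
  obtain ⟨r, hr⟩ := exists_eq_blockSite' hj x
  set y := blockOf x with hy
  have hL := P.hL.2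
  -- the image of `p′ = ⟨y′, μ, ν⟩` under `preflect` is injective in `y′`
  have himg : ∀ (q : Plaq P (j + 1)) (z : Balaban1983to89.Site P (j + 1)),
      (preflect ρ q = preflect ρ ⟨z, μ, ν, hμν⟩) ↔ q = ⟨z, μ, ν, hμν⟩ := fun q z =>
    ⟨fun h => by simpa using congrArg (preflect ρ) h, fun h => by rw [h]⟩
  rw [hr, BIJ85CurlQsstar.mem_edgeB_blockSite_iff hj hd p' y r hμν]
  by_cases hρ : μ = ρ ∨ ν = ρ
  · -- `ρ` is one of the directions: the base point of the image is `c_ρ(x + e_ρ)`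
    have hsrc : (preflect ρ (⟨Site.blockSite y r, μ, ν, hμν⟩ : Plaq P j)) =
        ⟨crefl ρ ((Site.blockSite y r).shift ρ), μ, ν, hμν⟩ := by simp [preflect, hρ]
    rw [hsrc]
    by_cases hedge : (r ρ : ℕ) + 1 = P.L
    · rw [BIJ85CurlQsstar.shift_blockSite_of_eq hj y r ρ hedge, crefl_blockSite hj,
        BIJ85CurlQsstar.mem_edgeB_blockSite_iff hj hd _ _ _ hμν]
      have hy' : (⟨crefl ρ (y.shift ρ), μ, ν, hμν⟩ : Plaq P (j + 1)) = preflect ρ ⟨y, μ, ν, hμν⟩ := by simp [preflect, hρ]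
      rw [hy', himg]
      have hflip : ∀ κ, ((flipOff ρ (Function.update r ρ ⟨0, P.L_pos⟩) κ : Fin P.L) : ℕ) + 1 = P.L ↔ ((r κ : ℕ) + 1 = P.L) := by
        intro κ
        rw [flipOff_apply_val]
        by_cases hκ : κ = ρ
        · subst hκ; simp [hedge]; omega
        · rw [if_neg hκ, Function.update_of_ne hκ]
      rw [hflip, hflip]
    · have hlt : (r ρ : ℕ) + 1 < P.L := by have := (r ρ).isLt; omega
      rw [BIJ85CurlQsstar.shift_blockSite_of_lt y r ρ hlt, crefl_blockSite hj, BIJ85CurlQsstar.mem_edgeB_blockSite_iff hj hd _ _ _ hμν]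
      have hno : ¬(((flipOff ρ (Function.update r ρ ⟨(r ρ : ℕ) + 1, hlt⟩) ρ : Fin P.L) : ℕ) + 1 = P.L) := by
        rw [flipOff_apply_val, if_pos rfl, Function.update_self]
        simp only
        omega
      constructor
      · rintro ⟨-, h1, h2⟩
        rcases hρ with h | h
        · subst h; exact absurd h1 hno
        · subst h; exact absurd h2 hno
      · rintro ⟨-, h1, h2⟩
        rcases hρ with h | h
        · subst h; exact absurd h1 hedge
        · subst h; exact absurd h2 hedge
  · have hsrc : (preflect ρ (⟨Site.blockSite y r, μ, ν, hμν⟩ : Plaq P j)) = ⟨crefl ρ (Site.blockSite y r), μ, ν, hμν⟩ := by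
      simp [preflect, hρ]
    rw [hsrc, crefl_blockSite hj, BIJ85CurlQsstar.mem_edgeB_blockSite_iff hj hd _ _ _ hμν]
    have hy' : (⟨crefl ρ y, μ, ν, hμν⟩ : Plaq P (j + 1)) = preflect ρ ⟨y, μ, ν, hμν⟩ := by simp [preflect, hρ]
    rw [hy', himg]
    have h1 : μ ≠ ρ := fun h => hρ (Or.inl h)
    have h2 : ν ≠ ρ := fun h => hρ (Or.inr h)
    rw [flipOff_apply_val, if_neg h1, flipOff_apply_val, if_neg h2]

/-- **`Q^{e*}` commutes with the reflections**: `Q^{e*}(c_ρg) = c_ρ(Q^{e*}g)` for the pull-back (2.22) of p31's `torusEdgeCells`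
(an edge plaquette and its coarse plaquette carry the same orientation sign; standing range). [cite: BalabanImbrieJaffe1985, (2.22) p.305] -/
theorem edgeQstar_reflP (hd : 2 ≤ P.d) (hj : j + 1 ≤ P.m + P.K) (ρ : Fin P.d) (g : Plaq P (j + 1) → ℝ) :
    (BIJ85CurlQsstar.torusEdgeCells P j hd).Qstar (reflP ρ g) = reflP ρ ((BIJ85CurlQsstar.torusEdgeCells P j hd).Qstar g) := by
  funext p
  rw [reflP_apply]
  unfold BIJ85CellAverages.Cells.Qstar
  rw [← (preflectEquiv (P := P) (j := j + 1) ρ).sum_comp]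
  simp only [preflectEquiv_apply]
  have hsign : ∀ c : Plaq P (j + 1), p ∈ (BIJ85CurlQsstar.torusEdgeCells P j hd).B c → ((c.μ = ρ ∨ c.ν = ρ) ↔ (p.μ = ρ ∨ p.ν = ρ)) := by
    intro c hc
    obtain ⟨e1, e2, -⟩ := (BIJ85CurlQsstar.mem_edgeB_iff hd c p).1 hc
    rw [e1, e2]
  by_cases hρ : p.μ = ρ ∨ p.ν = ρ
  · rw [if_pos hρ, ← Finset.sum_neg_distrib]
    refine Finset.sum_congr rfl fun c _ => ?_
    have hiff := mem_edgeB_preflect_iff hd hj ρ (preflect ρ c) p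
    rw [preflect_preflect] at hiff
    split_ifs with h1 h2 h2
    · rw [reflP_apply, if_pos ((hsign _ h1).2 hρ), preflect_preflect]; ring
    · exact absurd (hiff.2 h1) h2
    · exact absurd (hiff.1 h2) h1
    · simp
  · rw [if_neg hρ]
    refine Finset.sum_congr rfl fun c _ => ?_
    have hiff := mem_edgeB_preflect_iff hd hj ρ (preflect ρ c) p
    rw [preflect_preflect] at hiff
    split_ifs with h1 h2 h2
    · rw [reflP_apply, if_neg (fun h => hρ ((hsign _ h1).1 h)), preflect_preflect]
    · exact absurd (hiff.2 h1) h2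
    · exact absurd (hiff.1 h2) h1
    · rfl

/-- **`Q^{e*}_k` commutes with the reflections**: `Q^{e*}_k(c_ρg) = c_ρ(Q^{e*}_kg)` for p30's composite `BIJ85Eq531Inputs.QestarIter`
(induction through `Q^{e*}_{k+1} = Q^{e*}_kQ^{e*}`; standing range `k ≤ m + K`). [cite: BalabanImbrieJaffe1985, (2.24) p.305] -/
theorem QestarIter_reflP (hd : 2 ≤ P.d) (ρ : Fin P.d) : ∀ (k : ℕ), k ≤ P.m + P.K → ∀ (g : Plaq P k → ℝ),
    BIJ85Eq531Inputs.QestarIter hd k (reflP ρ g) = reflP ρ (BIJ85Eq531Inputs.QestarIter hd k g)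
  | 0, _, g => by simp
  | k + 1, hk, g => by
    rw [BIJ85Eq531Inputs.QestarIter_succ, BIJ85Eq531Inputs.QestarIter_succ, edgeQstar_reflP hd hk,
      QestarIter_reflP hd ρ k (by omega)]

/-! ## §A  Translations: the complements of `BIJ85SigmaTranslationInvariance` used by the Landau operators -/

section Transl

variable [AddCommGroup V] [Module ℝ V]

/-- The gradient commutes with every translation: `∂(τ_vλ) = τ_v(∂λ)`. [cite: BalabanImbrieJaffe1985, (2.7) p.303] -/
theorem grad_translS (c : ℝ) (v : Balaban1983to89.Site P j) (f : SiteField P j V) :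
    grad c (translS v f) = translV v (grad c f) := by
  funext b
  simp only [grad, translS_apply, translV_apply, PBond.translate, PBond.tgt, Site.shift_add]

/-- The divergence commutes with every translation: `∂*(τ_vA) = τ_v(∂*A)`. [cite: BalabanImbrieJaffe1985, (4.4.1) p.311] -/
theorem diverg_translV (c : ℝ) (v : Balaban1983to89.Site P j) (A : VecField P j V) :
    diverg c (translV v A) = translS v (diverg c A) := by
  funext x
  simp only [diverg, translS_apply, translV_apply, PBond.translate, Site.unshift_add]

/-- The Laplacian commutes with every translation: `Δ(τ_vλ) = τ_v(Δλ)`. [cite: BalabanImbrieJaffe1985, (4.4.1) p.311] -/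
theorem laplace_translS (c : ℝ) (v : Balaban1983to89.Site P j) (f : SiteField P j V) :
    laplace c (translS v f) = translS v (laplace c f) := by
  funext x
  simp only [laplace, translS_apply, Site.shift_add, Site.unshift_add]

end Transl

end

end Literature.MathematicalPhysics.QuantumFieldTheory.BalabanImbrieJaffe1984to88.BIJ85TorusReflections
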